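import Literature.NumberTheory.LFunctions.UniformClassGroupPNTGeneralDegreeInputs
import Literature.NumberTheory.NumberFields.ResidueLowerBoundAllFields
import HarnessLib

/-!
# `κ_K ≥ Q^{−A(n)}` for EVERY number field of degree `n` (`Q = |d_K| n^n`, Thorner–Zaman's size parameter)

Topic `Literature/NumberTheory/LFunctions`, namespace
`Literature.NumberTheory.LFunctions.NumberField.ThornerZaman` (the home of `condQn`).
Everything here is PROVED (theorems only, no definitions).

The residue hypothesis `P⁻¹ ≤ κ_K` / `condQn K ^ (−A) ≤ κ_K` carried by the tree's log-free
zero-density estimates for `ζ₁_K = (s−1)ζ_K` (`logFreeDensity_dedekindZeta₁_all`, and the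
degree-local class prime number theorems built on them) is discharged here for ALL number fields
of a given degree `n > 1`, with an exponent `A = A(n)` depending only on `n`:
`exists_condQn_rpow_neg_le_residue`.  Source of the bound: the effective
`κ_K ≥ c(n)/√|d_K|` of `Literature/NumberTheory/NumberFields/ResidueLowerBoundAllFields.lean`
(class number formula + regulator lower bound + `w_K ≤ W(n)`), and `|d_K| ≤ Q`, `Q ≥ 12`.
Unlike the Stark-type bound `κ_K ≥ Q^{−10}` of the tree (fields WITHOUT quadratic subfield,
`Stark1974_dedekindZeta_ne_zero_of_noQuadraticSubfield_holds`), no hypothesis on subfields is needed;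
the price is that `A(n)` is not explicit in `n`.

## References
* J. Thorner, A. Zaman, *A unified and improved Chebotarev density theorem*, Algebra & Number
  Theory 13 (2019), §3 (the size parameter `D_K 𝒬 n_K^{n_K}`). [ThornerZaman2019]
* H. M. Stark, Invent. Math. 23 (1974) 135–152 (effective residue bounds, context). [Stark1974]
-/

open Module NumberField

namespace Literature.NumberTheory.LFunctions.NumberField.ThornerZaman

open Literature.NumberTheory.NumberFields

/-- `|d_K| ≤ Q = |d_K| · n_K^{n_K}`. [folklore] -/
theorem abs_discr_le_condQn (K : Type*) [Field K] [NumberField K] :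
    |(discr K : ℝ)| ≤ condQn K := by
  unfold condQn
  have h1 : (1 : ℝ) ≤ (finrank ℚ K : ℝ) ^ finrank ℚ K :=
    one_le_pow₀ (by exact_mod_cast Module.finrank_pos (R := ℚ) (M := K))
  have hd : 0 ≤ |(discr K : ℝ)| := abs_nonneg _
  nlinarith

/-- **`κ_K ≥ Q^{−A(n)}` for every number field of degree `n > 1`** (`Q = condQn K = |d_K| n^n`;
`A(n) ≥ 0` effective, depending only on `n`): the residue lower bound needed by the log-free
zero-density / class-PNT chain, for ALL fields of the degree (quadratic subfields allowed).
From `κ_K ≥ c(n)/√|d_K|`, `√|d_K| ≤ Q^{1/2}` and `c(n) ≥ 12^{−A'} ≥ Q^{−A'}`.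
[cite: Stark1974, §1 (trivial effective Brauer–Siegel direction)] -/
theorem exists_condQn_rpow_neg_le_residue (n : ℕ) (hn : 1 < n) :
    ∃ A : ℝ, 0 ≤ A ∧ ∀ (K : Type) [Field K] [NumberField K], finrank ℚ K = n →
      condQn K ^ (-A) ≤ dedekindZeta_residue K := by
  obtain ⟨c, hc, h⟩ := exists_residue_ge_div_sqrt_of_finrank_eq n
  set c' : ℝ := min c 1 with hc'
  have hc'0 : 0 < c' := lt_min hc one_pos
  have hc'1 : c' ≤ 1 := min_le_right _ _
  have hlog12 : 0 < Real.log 12 := Real.log_pos (by norm_num)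
  set A' : ℝ := -Real.log c' / Real.log 12 with hA'def
  have hA' : 0 ≤ A' :=
    div_nonneg (neg_nonneg.mpr (Real.log_nonpos hc'0.le hc'1)) hlog12.le
  refine ⟨1 / 2 + A', by positivity, fun K _ _ hK => ?_⟩
  have hn' : 1 < finrank ℚ K := hK ▸ hn
  have hQ12 : 12 ≤ condQn K := twelve_le_condQn (K := K) hn'
  have hQ0 : 0 < condQn K := by linarith
  set d : ℝ := |(discr K : ℝ)| with hd
  have hd0 : 0 < d := abs_pos.mpr (Int.cast_ne_zero.mpr (discr_ne_zero K))
  have hdQ : d ≤ condQn K := abs_discr_le_condQn K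
  rw [neg_add, Real.rpow_add hQ0]
  have hhalf : condQn K ^ (-(1 / 2 : ℝ)) ≤ (Real.sqrt d)⁻¹ := by
    rw [Real.rpow_neg hQ0.le, Real.sqrt_eq_rpow]
    exact inv_anti₀ (Real.rpow_pos_of_pos hd0 _) (Real.rpow_le_rpow hd0.le hdQ (by norm_num))
  have hA'Q : condQn K ^ (-A') ≤ c' := by
    calc condQn K ^ (-A') ≤ (12 : ℝ) ^ (-A') :=
          Real.rpow_le_rpow_of_nonpos (by norm_num) hQ12 (neg_nonpos.mpr hA')
      _ = c' := by
          rw [Real.rpow_def_of_pos (by norm_num)]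
          have : Real.log 12 * -A' = Real.log c' := by
            rw [hA'def]
            field_simp
          rw [this, Real.exp_log hc'0]
  calc condQn K ^ (-(1 / 2 : ℝ)) * condQn K ^ (-A') ≤ (Real.sqrt d)⁻¹ * c' :=
        mul_le_mul hhalf hA'Q (Real.rpow_nonneg hQ0.le _) (inv_nonneg.mpr (Real.sqrt_nonneg _))
    _ = c' / Real.sqrt d := by rw [inv_mul_eq_div]
    _ ≤ c / Real.sqrt d := div_le_div_of_nonneg_right (min_le_left _ _) (Real.sqrt_nonneg _)
    _ ≤ dedekindZeta_residue K := h K hK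

end Literature.NumberTheory.LFunctions.NumberField.ThornerZaman
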